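import Summits.Parity.GeneralizedHardyLittlewood.Theorems.GreenTaoLevelTwoMNTwoMajorArcPiece

/-!
# Route `GreenTaoLevelTwo`, crux `MNTwo` (stmt-Parity-21276), line `birth`, stub `stub_mnVertical`:
# §12 summed over the tent pieces, parameters free (GT 2008b §12, eq. (dagger))

Block V6 of the `stub_mnVertical` census, PARAMETRIC TOTAL (B. Green, T. Tao, *Quadratic uniformity
of the Möbius function*, Ann. Inst. Fourier 58 (2008) = arXiv:math/0606087, §12: "Summing in `α`,
using the bounded overlap of the Bohr sets … we conclude (dagger)
`|𝔼_{N<n≤2N} μ(n)ψ(n)e(−φ(n))| ≪_{A'} (εκ)^{-C} q³ log^{-A'} N + ε + κ`. At this point we set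
`κ = ε = log^{-C(A+1)} N` …").  This def-free file sums the concrete piece estimate
`…MNTwoMajorArcPiece.norm_sum_moebius_major_arc_bohrPiece_le` over the `mᵏ·m` tent pieces
(`…MNTwoLocalPiece.sum_pieces_eq`), with crude (overlap-free) bookkeeping of the error terms, leaving
every parameter free:

* `norm_sum_moebius_major_arc_param_le` — for every `k`, `A > 0` there is `C ≥ 0` with
  `‖Σ_{N<n≤2N} μ(n)ψ(n)e(−φ(n))‖ ≤ mᵏ·m·(C q/√((η/16)^{k+1}/2)·N/log^A N + N(1+km+m)·2qη)
   + 2πKη(qη + 16/m)·Σψ`.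

What is left for Proposition 19 (the hypothesis `hP` of `…MNTwoSectionEight`): the major-arc
input (`q, K ≤ log^B N`, `ρ ≥ log^{-B} N`; blocks V4–V5) and the choice `m ≍ log^{B+3} N`,
`η = log^{-E} N` with `E` large, which makes the right-hand side `≪ N log^{-A} N`.

References: [GreenTao2008QuadraticMobius] arXiv:math/0606087 §12, eq. (dagger).
-/

noncomputable section

open Finset Real ArithmeticFunction
open scoped ArithmeticFunction.Moebius

namespace Summit.Parity.GeneralizedHardyLittlewood.GreenTaoLevelTwoMNTwoMajorArcSum

open Summit.Parity.GeneralizedHardyLittlewood.GreenTaoLevelTwoMNTwoMajorArcPiece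
  (norm_sum_moebius_major_arc_bohrPiece_le)
open Summit.Parity.GeneralizedHardyLittlewood.GreenTaoLevelTwoMNTwoLocalPiece
  (piece_nonneg_le sum_pieces_eq)

/-- **§12 with free parameters (GT 2008b §12, (dagger)).**  Hypotheses as in
`…MNTwoMajorArcPiece.norm_sum_moebius_major_arc_bohrPiece_le` (with mesh `m ≥ 2`); conclusion for
the whole weight `ψ`:
`‖Σ_{N<n≤2N} μ(n)ψ(n)e(−φ(n))‖ ≤ mᵏ·m·(C q/√((η/16)^{k+1}/2)·N/log^A N + N(1+km+m)·2qη)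
 + 2πKη(qη + 16/m) Σ_{(N,2N]} ψ`.
[cite: GreenTao2008QuadraticMobius, §12] -/
theorem norm_sum_moebius_major_arc_param_le (k : ℕ) {A : ℝ} (hA : 0 < A) :
    ∃ C : ℝ, 0 ≤ C ∧ ∀ N : ℕ, 2 ≤ N → ∀ (α : Fin k → ℝ) (n₀ : ℤ) (R K ρ r₁ η : ℝ) (q m : ℕ)
      (φ : ℤ → UnitAddCircle) (ψ : ℤ → ℝ),
      (∀ n u b c : ℤ,
        (⨆ i : Fin k, ‖((((n - n₀ : ℤ) : ℝ) * α i : ℝ) : AddCircle (1 : ℝ))‖) +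
            |((n - n₀ : ℤ) : ℝ)| / N < R →
        (⨆ i : Fin k, ‖((((n + u - n₀ : ℤ) : ℝ) * α i : ℝ) : AddCircle (1 : ℝ))‖) +
            |((n + u - n₀ : ℤ) : ℝ)| / N < R →
        (⨆ i : Fin k, ‖((((n + b - n₀ : ℤ) : ℝ) * α i : ℝ) : AddCircle (1 : ℝ))‖) +
            |((n + b - n₀ : ℤ) : ℝ)| / N < R →
        (⨆ i : Fin k, ‖((((n + c - n₀ : ℤ) : ℝ) * α i : ℝ) : AddCircle (1 : ℝ))‖) +
            |((n + c - n₀ : ℤ) : ℝ)| / N < R →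
        (⨆ i : Fin k, ‖((((n + u + b - n₀ : ℤ) : ℝ) * α i : ℝ) : AddCircle (1 : ℝ))‖) +
            |((n + u + b - n₀ : ℤ) : ℝ)| / N < R →
        (⨆ i : Fin k, ‖((((n + u + c - n₀ : ℤ) : ℝ) * α i : ℝ) : AddCircle (1 : ℝ))‖) +
            |((n + u + c - n₀ : ℤ) : ℝ)| / N < R →
        (⨆ i : Fin k, ‖((((n + b + c - n₀ : ℤ) : ℝ) * α i : ℝ) : AddCircle (1 : ℝ))‖) +
            |((n + b + c - n₀ : ℤ) : ℝ)| / N < R →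
        (⨆ i : Fin k, ‖((((n + u + b + c - n₀ : ℤ) : ℝ) * α i : ℝ) : AddCircle (1 : ℝ))‖) +
            |((n + u + b + c - n₀ : ℤ) : ℝ)| / N < R →
        φ (n + u + b + c) - φ (n + u + b) - φ (n + u + c) - φ (n + b + c)
          + φ (n + u) + φ (n + b) + φ (n + c) - φ n = 0) →
      1 ≤ q → 0 ≤ K → 0 < η → η ≤ 1 → (q : ℝ) * η ≤ ρ → (q : ℝ) * η ≤ 1 → 2 ≤ m →
      (8 : ℝ) / m ≤ ρ → r₁ + 2 * ρ ≤ R → 3 * ρ ≤ R →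
      (∀ u b : ℤ,
        (⨆ i : Fin k, ‖(((u : ℝ) * α i : ℝ) : AddCircle (1 : ℝ))‖) + |(u : ℝ)| / N < ρ →
        (⨆ i : Fin k, ‖(((b : ℝ) * α i : ℝ) : AddCircle (1 : ℝ))‖) + |(b : ℝ)| / N < ρ →
        ‖q • (φ (n₀ + u + b) - φ (n₀ + u) - φ (n₀ + b) + φ n₀)‖ ≤
          K * ((⨆ i : Fin k, ‖(((u : ℝ) * α i : ℝ) : AddCircle (1 : ℝ))‖) + |(u : ℝ)| / N) *
            ((⨆ i : Fin k, ‖(((b : ℝ) * α i : ℝ) : AddCircle (1 : ℝ))‖) + |(b : ℝ)| / N)) →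
      (∀ n, 0 ≤ ψ n) → (∀ n, ψ n ≤ 1) → (∀ n, ψ n ≠ 0 → (N : ℤ) < n ∧ n ≤ 2 * N) →
      (∀ n, ψ n ≠ 0 →
        (⨆ i : Fin k, ‖((((n - n₀ : ℤ) : ℝ) * α i : ℝ) : AddCircle (1 : ℝ))‖) +
          |((n - n₀ : ℤ) : ℝ)| / N < r₁) →
      (∀ n n' : ℤ, |ψ n - ψ n'| ≤
        (⨆ i : Fin k, ‖((((n - n' : ℤ) : ℝ) * α i : ℝ) : AddCircle (1 : ℝ))‖) +
          |((n - n' : ℤ) : ℝ)| / N) →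
      ‖∑ n ∈ Ioc N (2 * N), ((μ n : ℝ) : ℂ) * ((ψ n : ℝ) : ℂ) *
          ((AddCircle.toCircle (-φ n) : Circle) : ℂ)‖ ≤
        ((m : ℝ) ^ k * m) * (C * q / Real.sqrt ((η / 16) ^ (k + 1) / 2) * N / Real.log N ^ A +
          N * ((1 + k * m + m) * (2 * q * η))) +
          2 * Real.pi * (K * η * (q * η + 4 * (4 / m))) * ∑ n ∈ Ioc N (2 * N), ψ n := by
  obtain ⟨C, hC0, hC⟩ := norm_sum_moebius_major_arc_bohrPiece_le k hA
  refine ⟨C, hC0, ?_⟩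
  intro N hN α n₀ R K ρ r₁ η q m φ ψ hφ hq hK hη hη1 hqη hqη1 hm h8m hR hρR hMA hψ0 hψ1 hsupp hloc hlip
  classical
  have hm1 : 1 ≤ m := by omega
  -- the pieces
  set P : (Fin k → Fin m) → ℕ → ℤ → ℝ := fun a j n => ψ n * (∏ i, max 0 (1 - (m : ℝ) *
      ‖((((n : ℤ) : ℝ) * α i - ((a i : ℕ) : ℝ) / m : ℝ) : AddCircle (1 : ℝ))‖)) *
    max 0 (1 - (m : ℝ) * ‖((((n : ℤ) : ℝ) / (3 * N) - (j : ℝ) / m : ℝ) : AddCircle (1 : ℝ))‖)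
    with hPdef
  have hpiece : ∀ (a : Fin k → Fin m) (j : ℕ),
      ‖∑ n ∈ Ioc N (2 * N), ((μ n : ℝ) : ℂ) * ((P a j n : ℝ) : ℂ) *
          ((AddCircle.toCircle (-φ n) : Circle) : ℂ)‖ ≤
        C * q / Real.sqrt ((η / 16) ^ (k + 1) / 2) * N / Real.log N ^ A +
          2 * Real.pi * (K * η * (q * η + 4 * (4 / m))) * ∑ n ∈ Ioc N (2 * N), P a j n +
          N * ((1 + k * m + m) * (2 * q * η)) :=
    fun a j => hC N hN α n₀ R K ρ r₁ η q m φ ψ a j hφ hq hK hη hη1 hqη hqη1 hm1 h8m hR hρR hMA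
      hψ0 hψ1 hsupp hloc hlip
  -- decomposition of the sum
  have hdecomp : ∑ n ∈ Ioc N (2 * N), ((μ n : ℝ) : ℂ) * ((ψ n : ℝ) : ℂ) *
        ((AddCircle.toCircle (-φ n) : Circle) : ℂ) =
      ∑ a : Fin k → Fin m, ∑ j ∈ range m, ∑ n ∈ Ioc N (2 * N),
        ((μ n : ℝ) : ℂ) * ((P a j n : ℝ) : ℂ) * ((AddCircle.toCircle (-φ n) : Circle) : ℂ) := by
    have h1 : ∀ n ∈ Ioc N (2 * N), ((μ n : ℝ) : ℂ) * ((ψ n : ℝ) : ℂ) *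
        ((AddCircle.toCircle (-φ n) : Circle) : ℂ) =
        ∑ a : Fin k → Fin m, ∑ j ∈ range m,
          ((μ n : ℝ) : ℂ) * ((P a j n : ℝ) : ℂ) * ((AddCircle.toCircle (-φ n) : Circle) : ℂ) := by
      intro n _
      have e : ψ n = ∑ a : Fin k → Fin m, ∑ j ∈ range m, P a j n :=
        (sum_pieces_eq hm α N ψ n).symm
      rw [e]
      push_cast
      rw [Finset.mul_sum, Finset.sum_mul]
      refine Finset.sum_congr rfl fun a _ => ?_
      rw [Finset.mul_sum, Finset.sum_mul]
    rw [Finset.sum_congr rfl h1, Finset.sum_comm]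
    refine Finset.sum_congr rfl fun a _ => ?_
    rw [Finset.sum_comm]
  -- the sum of the pieces' masses
  have hmass : ∑ a : Fin k → Fin m, ∑ j ∈ range m, ∑ n ∈ Ioc N (2 * N), P a j n =
      ∑ n ∈ Ioc N (2 * N), ψ n := by
    have h2 : ∀ a : Fin k → Fin m, ∑ j ∈ range m, ∑ n ∈ Ioc N (2 * N), P a j n =
        ∑ n ∈ Ioc N (2 * N), ∑ j ∈ range m, P a j n := fun a => Finset.sum_comm
    rw [Finset.sum_congr rfl (fun a _ => h2 a), Finset.sum_comm]
    refine Finset.sum_congr rfl fun n _ => ?_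
    exact sum_pieces_eq hm α N ψ (n : ℤ)
  -- sum the piece estimates
  rw [hdecomp]
  have hcardA : (Fintype.card (Fin k → Fin m) : ℝ) = (m : ℝ) ^ k := by
    rw [Fintype.card_fun, Fintype.card_fin, Fintype.card_fin]; push_cast; ring
  set T : ℝ := C * q / Real.sqrt ((η / 16) ^ (k + 1) / 2) * N / Real.log N ^ A +
    N * ((1 + k * m + m) * (2 * q * η)) with hT
  set ε' : ℝ := 2 * Real.pi * (K * η * (q * η + 4 * (4 / m))) with hε'
  calc ‖∑ a : Fin k → Fin m, ∑ j ∈ range m, ∑ n ∈ Ioc N (2 * N),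
          ((μ n : ℝ) : ℂ) * ((P a j n : ℝ) : ℂ) * ((AddCircle.toCircle (-φ n) : Circle) : ℂ)‖
      ≤ ∑ a : Fin k → Fin m, ∑ j ∈ range m, ‖∑ n ∈ Ioc N (2 * N),
          ((μ n : ℝ) : ℂ) * ((P a j n : ℝ) : ℂ) * ((AddCircle.toCircle (-φ n) : Circle) : ℂ)‖ :=
        (norm_sum_le _ _).trans (Finset.sum_le_sum fun a _ => norm_sum_le _ _)
    _ ≤ ∑ a : Fin k → Fin m, ∑ j ∈ range m, (T + ε' * ∑ n ∈ Ioc N (2 * N), P a j n) :=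
        Finset.sum_le_sum fun a _ => Finset.sum_le_sum fun j _ => by
          have := hpiece a j; rw [hT, hε']; linarith
    _ = ((m : ℝ) ^ k * m) * T + ε' * ∑ n ∈ Ioc N (2 * N), ψ n := by
        have hTsum : ∑ _a : Fin k → Fin m, ∑ _j ∈ range m, T = (m : ℝ) ^ k * m * T := by
          simp only [Finset.sum_const, Finset.card_range, Finset.card_univ, nsmul_eq_mul]
          rw [hcardA]; ring
        have hεsum : ∑ a : Fin k → Fin m, ∑ j ∈ range m, ε' * ∑ n ∈ Ioc N (2 * N), P a j n =
            ε' * ∑ n ∈ Ioc N (2 * N), ψ n := by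
          rw [← hmass, Finset.mul_sum]
          refine Finset.sum_congr rfl fun a _ => ?_
          rw [Finset.mul_sum]
        rw [← hTsum, ← hεsum, ← Finset.sum_add_distrib]
        refine Finset.sum_congr rfl fun a _ => ?_
        rw [← Finset.sum_add_distrib]
    _ = _ := by rw [hT, hε']

end Summit.Parity.GeneralizedHardyLittlewood.GreenTaoLevelTwoMNTwoMajorArcSum
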